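import Summits.AtomisticToContinuum.FouriersLaw.Theses.OddSectorIrreversibility

/-!
# Sketch — crux-ideate `stmt-AtomisticToContinuum-9141` (`BoundedResponseConverges`), round 1, ideator 1

Idea `two-scale-gluing-log-rigidity`: under the crux's own boundedness hypothesis, convergence of the
finite-size conductivity `D_N` to a positive limit follows from
* (U)   `UpperIncrement`      — one more bead raises the bath-to-bath resistance `R_N = (N-1)/D_N` by at most `C'`;
* (S23) `SelfSimilarGluing`   — ONE-SIDED, SUB-EXTENSIVE subadditivity at the two self-similar junctions only:
                                `R_{2N} ≤ 2 R_N + N ε(N)`, `R_{3N} ≤ 3 R_N + N ε(N)` with `ε ↓ 0`, `Σ_k ε(2^k) < ∞`;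
* the pure real-analysis glue `LogScaleRigidity` (a restricted Fekete lemma: slowly decreasing in `log N`
  + almost nondecreasing under `×2` and `×3` ⇒ convergent, by Kronecker density of `ℕ log 2 + ℕ log 3`).
Nothing here is proved; every declaration is a `Prop` (statement shapes that elaborate). The composition
`CompositionClaim` is what a crux-plan skeleton would prove sorry-free.
-/

namespace Summit.AtomisticToContinuum.FouriersLaw.Cruxes.BoundedResponseConverges.TwoScaleGluing

open Filter Topology
open Literature.MathematicalPhysics.KineticTheory.HeatConduction

/-- FIRST LEMMA (pure real analysis; the glue of the line). A sequence `d` which is eventually bounded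
below by `c > 0`, bounded above by `S`, SLOWLY DECREASING in log scale (`d N - d (N+1) ≤ C/N`) and
ALMOST NONDECREASING UNDER DOUBLING AND TRIPLING with an antitone slack `ε` that is summable along
`2^k` (a Dini condition in `log N`), converges to a positive limit. Proof sketch (paper, NOTES.md):
`limsup = liminf` via density of `{a log 2 + b log 3 : a b : ℕ}` at infinity + the log-Lipschitz lower
modulus; no subadditivity for general splits is used (contrast Fekete / de Bruijn–Erdős). -/
def LogScaleRigidity : Prop :=
  ∀ (d : ℕ → ℝ) (S C c : ℝ) (ε : ℕ → ℝ) (N₀ : ℕ), 0 < c →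
    (∀ N : ℕ, N₀ ≤ N → c ≤ d N) → (∀ N : ℕ, d N ≤ S) →
    (∀ N : ℕ, N₀ ≤ N → d N - d (N + 1) ≤ C / N) →
    Antitone ε → Summable (fun k : ℕ => ε (2 ^ k)) →
    (∀ N : ℕ, N₀ ≤ N → d N - ε N ≤ d (2 * N)) →
    (∀ N : ℕ, N₀ ≤ N → d N - ε N ≤ d (3 * N)) →
    ∃ k : ℝ, 0 < k ∧ Tendsto d atTop (𝓝 k)

/-- The number-theoretic input of `LogScaleRigidity`: the additive semigroup generated by `log 2` and
`log 3` is eventually `δ`-dense for every `δ > 0` (irrationality of `log 3 / log 2`, i.e. `2^p ≠ 3^q`,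
plus Dirichlet's pigeonhole), with approximation FROM BELOW. -/
def LogTwoLogThreeDense : Prop :=
  ∀ δ : ℝ, 0 < δ → ∃ X₀ : ℝ, ∀ X : ℝ, X₀ ≤ X →
    ∃ a b : ℕ, X - δ ≤ a * Real.log 2 + b * Real.log 3 ∧ a * Real.log 2 + b * Real.log 3 ≤ X

/-- The crux's common prefix (parameters `> 0`, weak-NESS uniqueness, a steady-state family, `T > 0`,
response coefficients `D` of clause (ii)), abstracted over a property `Φ` of the response sequence.
Constants inside `Φ` may depend on everything quantified before. Verbatim the binders of
`Theses.OddSectorIrreversibility.BoundedResponseConverges` minus its last two hypotheses. -/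
def WithResponse (Φ : (ℕ → ℝ) → Prop) : Prop :=
  ∀ ω₂ lam β γ : ℝ, 0 < ω₂ → 0 < lam → 0 < β → 0 < γ →
    (∀ (N : ℕ) (T_L T_R : ℝ), 0 < T_L → 0 < T_R →
      ∀ μ ν : MeasureTheory.Measure (PhaseSpace N),
        (pinnedChain ω₂ lam β γ).IsSteadyState N T_L T_R μ →
        (pinnedChain ω₂ lam β γ).IsSteadyState N T_L T_R ν → μ = ν) →
    ∀ μ : (N : ℕ) → ℝ → ℝ → MeasureTheory.Measure (PhaseSpace N),
      (∀ (N : ℕ) (T_L T_R : ℝ), 0 < T_L → 0 < T_R →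
        (pinnedChain ω₂ lam β γ).IsSteadyState N T_L T_R (μ N T_L T_R)) →
      ∀ T : ℝ, 0 < T → ∀ D : ℕ → ℝ,
        (∀ N : ℕ, Tendsto (fun δ : ℝ =>
            (pinnedChain ω₂ lam β γ).totalCurrent (μ N (T + δ / 2) (T - δ / 2)) / δ)
          (𝓝[≠] 0) (𝓝 (D N))) →
        Φ D

/-- The bath-to-bath linear-response RESISTANCE of the `N`-chain read off a response sequence:
`R_N = (N-1)/D_N` (junk where `D_N = 0`; used only under `0 < D_N`). -/
noncomputable def resistance (D : ℕ → ℝ) (N : ℕ) : ℝ := ((N : ℝ) - 1) / D N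

/-- STUB SHAPE (U) `UpperIncrement` — "one more bead costs at most `C'`": eventually `D_N > 0` and
`R_{N+1} ≤ R_N + C'` (note `R_{N+1} = N / D_{N+1}`). One-sided and LOCAL (a single site at the contact);
under the crux's `D_N ≤ S` it yields the slowly-decreasing modulus `D_N - D_{N+1} ≤ C' S² / N` AND the
floor `liminf D_N ≥ 1/C'` (positivity of the limit comes from here, for free). -/
def UpperIncrement : Prop :=
  WithResponse fun D => ∃ C : ℝ, ∃ N₀ : ℕ, ∀ N : ℕ, N₀ ≤ N →
    0 < D N ∧ resistance D (N + 1) ≤ resistance D N + C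

/-- STUB SHAPE (S23) `SelfSimilarGluing` — ONE-SIDED subadditivity at the two SELF-SIMILAR junctions
only (`N ⊕ N` and `N ⊕ N ⊕ N`, both reflection-symmetric configurations), with SUB-EXTENSIVE slack:
`R_{2N} ≤ 2R_N + N ε(N)`, `R_{3N} ≤ 3R_N + N ε(N)`, `ε` antitone and summable along `2^k`
(e.g. `ε(N) = (log N)^{-1-α}` or `N^{-η}` — gluing with a mesoscopic repair window is allowed to lose
`o(N)` resistance). Under `D_N ≤ S` it yields `D_{2N} ≥ D_N - S² ε(N)`, `D_{3N} ≥ D_N - S² ε(N)/2`. -/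
def SelfSimilarGluing : Prop :=
  WithResponse fun D => ∃ ε : ℕ → ℝ, Antitone ε ∧ Summable (fun k : ℕ => ε (2 ^ k)) ∧
    ∃ N₀ : ℕ, ∀ N : ℕ, N₀ ≤ N →
      resistance D (2 * N) ≤ 2 * resistance D N + N * ε N ∧
      resistance D (3 * N) ≤ 3 * resistance D N + N * ε N

/-- What a crux-plan skeleton for this idea proves sorry-free (composition; arithmetic + `LogScaleRigidity`):
the three statements above imply the crux BY NAME. Stated here as a `Prop` only. -/
def CompositionClaim : Prop :=
  LogScaleRigidity → UpperIncrement → SelfSimilarGluing →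
    Summit.AtomisticToContinuum.FouriersLaw.Theses.OddSectorIrreversibility.BoundedResponseConverges

/-- Sanity: the crux decl is the one all four owner routes share (same normalised signature); the
TransferKernelPositivity / LocalOhmBV / MatthiessenLadder copies are closed by the same composition. -/
example : CompositionClaim = (LogScaleRigidity → UpperIncrement → SelfSimilarGluing →
    Summit.AtomisticToContinuum.FouriersLaw.Theses.OddSectorIrreversibility.BoundedResponseConverges) := rfl

end Summit.AtomisticToContinuum.FouriersLaw.Cruxes.BoundedResponseConverges.TwoScaleGluing
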